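import Mathlib
import Literature.Computability.Complexity.CliqueTestGraphs
import Literature.Computability.Complexity.Rossman2008CliqueProofs
import Summits.PneNP.PneNP.Theorems.ConvexRankGatesConvexGateBlindCanonicalForm

/-!
# PneNP / ConvexRankGates — `ConvexGateBlind`: negative covers (an ε-free necessary condition of the crux)

Helpers (`--supports stmt-PneNP-10680`). By the canonical form (`convexGateBlind_iff_cliqueDistConeRankHard`)
the crux says that for every `ε > 0` the shifted one-sided clique-distance matrix `D - εJ`
(`D[Q,u] = #(E(Q) ∖ u)`, `Q` the `k`-sets, `u` the `k`-clique-free graphs of `K_m`, `k = ⌈m^δ⌉₊`) has no small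
`(PSD_q ⊕ ℝ^r_{≥0})`-factorisation. The column space of `D` (as functions of `Q`) is spanned by the pair indicators
`[e ⊆ Q]`; a non-negative factorisation of `D - εJ` whose `Q`-side factors lie in that span — the class that contains
the trivial factorisation `D = ∑_e [e ⊆ Q] ⊗ [e ∉ u]` and every Yannakakis-type (rational) refutation built from it —
exists for SOME `ε > 0` iff there is a NEGATIVE COVER: edge weightings `t₁, …, t_s` of `K_m`, each with non-negative
total weight on every `k`-set, such that every `k`-clique-free graph `u` carries a conic combination `∑ μ_j t_j` that
is `≤ -1` on every edge of `u` (and `≤ Λ` everywhere). This file proves the two elementary halves of that statement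
that matter for the item:

* `cliqueDist_sub_factorisation_of_negCover` — a negative cover of size `s` gives an EXPLICIT non-negative
  factorisation of `D - εJ` with `s + #E` terms and `ε = C(k,2)/(1+Λ)`; hence (`not_cliqueDistConeRankHard_of_negCover`)
  it refutes the canonical statement at that `m` as soon as `s + #E` fits the budget, and
  (`negCoverHard_of_convexGateBlind`) the crux implies that eventually NO negative cover of size `≤ m^c` exists —
  an ε-free, purely combinatorial necessary condition of `ConvexGateBlind` (and an ε-free sufficient condition for
  refuting it);
* `exists_neg_sum_of_negCover` / `card_le_mul_of_negCover` — the counting interface for lower bounds on negative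
  covers: a graph covered by the family has negative total weight under ONE generator, so
  `#𝒰 ≤ s · max_t #{u ∈ 𝒰 : t(u) < 0}` for every finite family `𝒰` of clique-free graphs.
[folklore; the factorisation is the `q = 0` slice of the canonical form of `…CanonicalForm.lean`]
-/

namespace Summit.PneNP.PneNP.Theorems

open Matrix Finset Literature.Computability.Complexity

/-- The clique vector of `Q` switches on exactly `C(#Q, 2)` edges (real-valued count). [folklore] -/
theorem sum_ite_cliqueVec_eq_choose {m : ℕ} (Q : Finset (Fin m)) :
    ∑ e : (⊤ : SimpleGraph (Fin m)).edgeSet, (if cliqueVec Q e = true then (1 : ℝ) else 0) = (Q.card.choose 2 : ℝ) := by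
  classical
  rw [Finset.sum_boole, Literature.Computability.Complexity.card_filter_cliqueVec Q]

/-- **Negative covers give factorisations of `D - εJ`.** Let `t₁, …, t_s` be edge weightings of `K_m` with
non-negative total weight on (the edges of) every `k`-set, and suppose every `k`-clique-free graph `u` carries
non-negative coefficients `μ(u)` with `∑_j μ_j(u) t_j ≤ -1` on every edge of `u` and `≤ Λ` on every edge. Then
`D[Q,u] - C(k,2)/(1+Λ) = ∑_l U_{u,l} V_{l,Q}` with `U, V ≥ 0` and `s + #E` terms: the generators are
`V_j(Q) = t_j(E(Q))` and `V_e(Q) = [e ⊆ Q]`, the coefficients `U_{u,j} = μ_j(u)/(1+Λ)` and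
`U_{u,e} = [e ∉ u] - (1 + ∑_j μ_j(u) t_j(e))/(1+Λ)`. [folklore] -/
theorem cliqueDist_sub_factorisation_of_negCover {m k s : ℕ}
    (t : Fin s → (⊤ : SimpleGraph (Fin m)).edgeSet → ℝ)
    (ht : ∀ j (Q : Finset (Fin m)), Q.card = k → 0 ≤ ∑ e, if cliqueVec Q e = true then t j e else 0)
    (μ : ((⊤ : SimpleGraph (Fin m)).edgeSet → Bool) → Fin s → ℝ) (hμ : ∀ u j, 0 ≤ μ u j)
    (Λ : ℝ) (hΛ : 0 ≤ Λ)
    (hneg : ∀ u, cliqueFn m k u = false → ∀ e, u e = true → ∑ j, μ u j * t j e ≤ -1)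
    (hbd : ∀ u, cliqueFn m k u = false → ∀ e, ∑ j, μ u j * t j e ≤ Λ) :
    ∃ (U : ((⊤ : SimpleGraph (Fin m)).edgeSet → Bool) → (Fin s ⊕ (⊤ : SimpleGraph (Fin m)).edgeSet) → ℝ)
      (V : (Fin s ⊕ (⊤ : SimpleGraph (Fin m)).edgeSet) → Finset (Fin m) → ℝ),
      (∀ u l, 0 ≤ U u l) ∧ (∀ l Q, 0 ≤ V l Q) ∧
      ∀ (Q : Finset (Fin m)) (u : (⊤ : SimpleGraph (Fin m)).edgeSet → Bool), Q.card = k → cliqueFn m k u = false →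
        (∑ e, if cliqueVec Q e = true ∧ u e = false then (1 : ℝ) else 0) - (k.choose 2 : ℝ) / (1 + Λ) =
          ∑ l, U u l * V l Q := by
  classical
  have h1Λ : 0 < 1 + Λ := by linarith
  set ε' : ℝ := 1 / (1 + Λ) with hε'
  have hε'pos : 0 < ε' := by rw [hε']; positivity
  have hε'Λ : ε' * (1 + Λ) = 1 := by rw [hε']; field_simp
  refine ⟨fun u l => Sum.elim (fun j => ε' * μ u j)
      (fun f => if cliqueFn m k u = false then
        (if u f = true then (0 : ℝ) else 1) - ε' * (1 + ∑ j, μ u j * t j f) else 0) l,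
    fun l Q => Sum.elim (fun j => if Q.card = k then ∑ e, (if cliqueVec Q e = true then t j e else 0) else 0)
      (fun f => if cliqueVec Q f = true then (1 : ℝ) else 0) l, ?_, ?_, ?_⟩
  · -- `U ≥ 0`
    intro u l
    cases l with
    | inl j => exact mul_nonneg hε'pos.le (hμ u j)
    | inr f =>
      simp only [Sum.elim_inr]
      split_ifs with hu huf
      · have h := hneg u hu f huf
        have : ε' * (1 + ∑ j, μ u j * t j f) ≤ 0 :=
          mul_nonpos_of_nonneg_of_nonpos hε'pos.le (by linarith)
        linarith
      · have h := hbd u hu f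
        have : ε' * (1 + ∑ j, μ u j * t j f) ≤ ε' * (1 + Λ) :=
          mul_le_mul_of_nonneg_left (by linarith) hε'pos.le
        linarith
      · exact le_rfl
  · -- `V ≥ 0`
    intro l Q
    cases l with
    | inl j =>
      simp only [Sum.elim_inl]
      split_ifs with hQ
      · exact ht j Q hQ
      · exact le_rfl
    | inr f =>
      simp only [Sum.elim_inr]
      split_ifs <;> norm_num
  · -- the identity
    intro Q u hQ hu
    have hcount : ∑ e : (⊤ : SimpleGraph (Fin m)).edgeSet, (if cliqueVec Q e = true then (1 : ℝ) else 0) =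
        (k.choose 2 : ℝ) := by rw [sum_ite_cliqueVec_eq_choose, hQ]
    -- left-hand side, edge by edge
    have hL : (∑ e, if cliqueVec Q e = true ∧ u e = false then (1 : ℝ) else 0) - (k.choose 2 : ℝ) / (1 + Λ) =
        ∑ e : (⊤ : SimpleGraph (Fin m)).edgeSet,
          (if cliqueVec Q e = true then (if u e = true then (0 : ℝ) else 1) - ε' else 0) := by
      have hdiv : (k.choose 2 : ℝ) / (1 + Λ) = ε' * (k.choose 2 : ℝ) := by rw [hε']; ring
      rw [hdiv, ← hcount, Finset.mul_sum, ← Finset.sum_sub_distrib]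
      refine Finset.sum_congr rfl fun e _ => ?_
      by_cases hc : cliqueVec Q e = true <;> by_cases hue : u e = true <;> simp [hc, hue]
    -- right-hand side, edge by edge
    have hA : ∑ j : Fin s, ε' * μ u j *
        (if Q.card = k then ∑ e, (if cliqueVec Q e = true then t j e else 0) else 0) =
        ∑ e : (⊤ : SimpleGraph (Fin m)).edgeSet,
          (if cliqueVec Q e = true then ε' * ∑ j, μ u j * t j e else 0) := by
      simp only [if_pos hQ, Finset.mul_sum]
      rw [Finset.sum_comm]
      refine Finset.sum_congr rfl fun e _ => ?_
      by_cases hc : cliqueVec Q e = true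
      · simp only [if_pos hc]
        exact Finset.sum_congr rfl fun j _ => by ring
      · simp only [if_neg hc, mul_zero, Finset.sum_const_zero]
    have hB : ∑ f : (⊤ : SimpleGraph (Fin m)).edgeSet,
        (if cliqueFn m k u = false then
          (if u f = true then (0 : ℝ) else 1) - ε' * (1 + ∑ j, μ u j * t j f) else 0) *
          (if cliqueVec Q f = true then (1 : ℝ) else 0) =
        ∑ f : (⊤ : SimpleGraph (Fin m)).edgeSet,
          (if cliqueVec Q f = true then
            (if u f = true then (0 : ℝ) else 1) - ε' * (1 + ∑ j, μ u j * t j f) else 0) := by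
      refine Finset.sum_congr rfl fun f _ => ?_
      rw [if_pos hu]
      by_cases hc : cliqueVec Q f = true
      · rw [if_pos hc, if_pos hc, mul_one]
      · rw [if_neg hc, if_neg hc, mul_zero]
    rw [hL, Fintype.sum_sum_type]
    simp only [Sum.elim_inl, Sum.elim_inr]
    rw [hA, hB, ← Finset.sum_add_distrib]
    refine Finset.sum_congr rfl fun e _ => ?_
    by_cases hc : cliqueVec Q e = true
    · simp only [if_pos hc]
      ring
    · simp only [if_neg hc, add_zero]

/-- **A negative cover refutes the canonical statement at `m`.** If `2 ≤ k` and a negative cover of size `s` with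
`s + #E(K_m) ≤ S` exists, then it is false that "for every `ε > 0`, `D - εJ` has no `(PSD_q ⊕ ℝ^r_{≥0})`-factorisation
with `q + r ≤ S`" (take `q = 0`, `ε = C(k,2)/(1+Λ)` and the factorisation of
`cliqueDist_sub_factorisation_of_negCover`). [folklore] -/
theorem not_cliqueDistConeRankHard_of_negCover {m k s S : ℕ} (hk : 2 ≤ k)
    (hS : s + Fintype.card (⊤ : SimpleGraph (Fin m)).edgeSet ≤ S)
    (t : Fin s → (⊤ : SimpleGraph (Fin m)).edgeSet → ℝ)
    (ht : ∀ j (Q : Finset (Fin m)), Q.card = k → 0 ≤ ∑ e, if cliqueVec Q e = true then t j e else 0)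
    (μ : ((⊤ : SimpleGraph (Fin m)).edgeSet → Bool) → Fin s → ℝ) (hμ : ∀ u j, 0 ≤ μ u j)
    (Λ : ℝ) (hΛ : 0 ≤ Λ)
    (hneg : ∀ u, cliqueFn m k u = false → ∀ e, u e = true → ∑ j, μ u j * t j e ≤ -1)
    (hbd : ∀ u, cliqueFn m k u = false → ∀ e, ∑ j, μ u j * t j e ≤ Λ) :
    ¬ ∀ ε : ℝ, 0 < ε → ∀ (q r : ℕ), q + r ≤ S →
      ∀ (H : ((⊤ : SimpleGraph (Fin m)).edgeSet → Bool) → Matrix (Fin q) (Fin q) ℝ) (Y : Finset (Fin m) → Matrix (Fin q) (Fin q) ℝ)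
        (U : ((⊤ : SimpleGraph (Fin m)).edgeSet → Bool) → Fin r → ℝ) (V : Fin r → Finset (Fin m) → ℝ),
        (∀ u, cliqueFn m k u = false → (H u).PosSemidef) →
        (∀ Q : Finset (Fin m), Q.card = k → (Y Q).PosSemidef) →
        (∀ u l, 0 ≤ U u l) → (∀ l Q, 0 ≤ V l Q) →
        ¬ ∀ (Q : Finset (Fin m)) (u : (⊤ : SimpleGraph (Fin m)).edgeSet → Bool), Q.card = k → cliqueFn m k u = false →
            (∑ e, if cliqueVec Q e = true ∧ u e = false then (1 : ℝ) else 0) - ε =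
              (H u * Y Q).trace + ∑ l, U u l * V l Q := by
  classical
  intro hhard
  obtain ⟨U, V, hU, hV, hfact⟩ := cliqueDist_sub_factorisation_of_negCover t ht μ hμ Λ hΛ hneg hbd
  -- reindex `Fin s ⊕ E` by `Fin r`
  set r := Fintype.card (Fin s ⊕ (⊤ : SimpleGraph (Fin m)).edgeSet) with hr
  have hrS : 0 + r ≤ S := by
    rw [hr, Fintype.card_sum, Fintype.card_fin]
    omega
  set eR := Fintype.equivFin (Fin s ⊕ (⊤ : SimpleGraph (Fin m)).edgeSet) with heR
  have hε : 0 < (k.choose 2 : ℝ) / (1 + Λ) := by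
    have h2 : 0 < k.choose 2 := Nat.choose_pos hk
    have h1 : (0 : ℝ) < k.choose 2 := by exact_mod_cast h2
    positivity
  refine hhard _ hε 0 r hrS (fun _ => 0) (fun _ => 0) (fun u i => U u (eR.symm i)) (fun i Q => V (eR.symm i) Q)
    (fun _ _ => Matrix.PosSemidef.zero) (fun _ _ => Matrix.PosSemidef.zero) (fun u i => hU u _) (fun i Q => hV _ Q)
    fun Q u hQ hu => ?_
  rw [hfact Q u hQ hu, Matrix.zero_mul, Matrix.trace_zero, zero_add,
    ← Equiv.sum_comp eR.symm (fun l => U u l * V l Q)]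

/-- **The crux implies negative-cover hardness (fixed `δ`, canonical form).** If the canonical cone-rank statement
holds for `δ > 0`, then for every `c`, eventually in `m`, there is NO negative cover of size `s ≤ m^c` for
`k = ⌈m^δ⌉₊`: no `s` edge weightings of `K_m`, non-negative on every `k`-set, such that every `k`-clique-free graph
carries a conic combination that is `≤ -1` on each of its edges and `≤ Λ` on every edge. [folklore] -/
theorem negCoverHard_of_cliqueDistConeRankHard {δ : ℝ} (hδ : 0 < δ)
    (hhard : ∀ c : ℕ, ∀ᶠ m : ℕ in Filter.atTop, ∀ ε : ℝ, 0 < ε → ∀ (q r : ℕ), q + r ≤ m ^ c →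
      ∀ (H : ((⊤ : SimpleGraph (Fin m)).edgeSet → Bool) → Matrix (Fin q) (Fin q) ℝ) (Y : Finset (Fin m) → Matrix (Fin q) (Fin q) ℝ)
        (U : ((⊤ : SimpleGraph (Fin m)).edgeSet → Bool) → Fin r → ℝ) (V : Fin r → Finset (Fin m) → ℝ),
        (∀ u, cliqueFn m ⌈(m : ℝ) ^ δ⌉₊ u = false → (H u).PosSemidef) →
        (∀ Q : Finset (Fin m), Q.card = ⌈(m : ℝ) ^ δ⌉₊ → (Y Q).PosSemidef) →
        (∀ u l, 0 ≤ U u l) → (∀ l Q, 0 ≤ V l Q) →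
        ¬ ∀ (Q : Finset (Fin m)) (u : (⊤ : SimpleGraph (Fin m)).edgeSet → Bool), Q.card = ⌈(m : ℝ) ^ δ⌉₊ → cliqueFn m ⌈(m : ℝ) ^ δ⌉₊ u = false →
            (∑ e, if cliqueVec Q e = true ∧ u e = false then (1 : ℝ) else 0) - ε =
              (H u * Y Q).trace + ∑ l, U u l * V l Q) :
    ∀ c : ℕ, ∀ᶠ m : ℕ in Filter.atTop, ∀ s : ℕ, s ≤ m ^ c →
      ∀ (t : Fin s → (⊤ : SimpleGraph (Fin m)).edgeSet → ℝ)
        (μ : ((⊤ : SimpleGraph (Fin m)).edgeSet → Bool) → Fin s → ℝ) (Λ : ℝ),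
        (∀ j (Q : Finset (Fin m)), Q.card = ⌈(m : ℝ) ^ δ⌉₊ → 0 ≤ ∑ e, if cliqueVec Q e = true then t j e else 0) →
        (∀ u j, 0 ≤ μ u j) → 0 ≤ Λ →
        (∀ u, cliqueFn m ⌈(m : ℝ) ^ δ⌉₊ u = false → ∀ e, ∑ j, μ u j * t j e ≤ Λ) →
        ¬ ∀ u, cliqueFn m ⌈(m : ℝ) ^ δ⌉₊ u = false → ∀ e, u e = true → ∑ j, μ u j * t j e ≤ -1 := by
  intro c
  filter_upwards [hhard (c + 3), Filter.eventually_ge_atTop 2] with m hm hm2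
  intro s hs t μ Λ ht hμ hΛ hbd hneg
  have hk : 2 ≤ ⌈(m : ℝ) ^ δ⌉₊ := by
    have hm1 : (1 : ℝ) < m := by exact_mod_cast hm2
    have h1 : (1 : ℝ) < (m : ℝ) ^ δ := Real.one_lt_rpow hm1 hδ
    have h1' : 1 < ⌈(m : ℝ) ^ δ⌉₊ := Nat.lt_ceil.mpr (by exact_mod_cast h1)
    omega
  have hE : Fintype.card (⊤ : SimpleGraph (Fin m)).edgeSet ≤ m ^ 2 := card_edgeSet_top_le m
  have hS : s + Fintype.card (⊤ : SimpleGraph (Fin m)).edgeSet ≤ m ^ (c + 3) := by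
    have h1 : 1 ≤ m := by omega
    have e1 : m ^ c ≤ m ^ (c + 2) := Nat.pow_le_pow_right h1 (by omega)
    have e2 : m ^ 2 ≤ m ^ (c + 2) := Nat.pow_le_pow_right h1 (by omega)
    have e3 : 2 * m ^ (c + 2) ≤ m ^ (c + 3) := by
      calc 2 * m ^ (c + 2) = m ^ (c + 2) * 2 := Nat.mul_comm _ _
        _ ≤ m ^ (c + 2) * m := Nat.mul_le_mul_left _ hm2
        _ = m ^ (c + 3) := (pow_succ m (c + 2)).symm
    omega
  exact not_cliqueDistConeRankHard_of_negCover hk hS t ht μ hμ Λ hΛ hneg hbd hm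

/-- **`ConvexGateBlind` implies negative-cover hardness.** If the crux holds then for some `δ ∈ (0, 1/2)` and every
`c`, eventually in `m`, the `⌈m^δ⌉₊`-clique-free graphs of `K_m` admit no negative cover by `s ≤ m^c` edge weightings
that are non-negative on every `⌈m^δ⌉₊`-set. Contrapositive (the refuter's reading): negative covers of polynomial
size for every `δ ∈ (0,1/2)`, infinitely often in `m`, refute the crux — an ε-free sufficient condition.
[folklore; via `convexGateBlind_iff_cliqueDistConeRankHard`] -/
theorem negCoverHard_of_convexGateBlind :
    Summit.PneNP.PneNP.Theses.ConvexRankGates.ConvexGateBlind →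
    ∃ δ : ℝ, 0 < δ ∧ δ < 1 / 2 ∧ ∀ c : ℕ, ∀ᶠ m : ℕ in Filter.atTop, ∀ s : ℕ, s ≤ m ^ c →
      ∀ (t : Fin s → (⊤ : SimpleGraph (Fin m)).edgeSet → ℝ)
        (μ : ((⊤ : SimpleGraph (Fin m)).edgeSet → Bool) → Fin s → ℝ) (Λ : ℝ),
        (∀ j (Q : Finset (Fin m)), Q.card = ⌈(m : ℝ) ^ δ⌉₊ → 0 ≤ ∑ e, if cliqueVec Q e = true then t j e else 0) →
        (∀ u j, 0 ≤ μ u j) → 0 ≤ Λ →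
        (∀ u, cliqueFn m ⌈(m : ℝ) ^ δ⌉₊ u = false → ∀ e, ∑ j, μ u j * t j e ≤ Λ) →
        ¬ ∀ u, cliqueFn m ⌈(m : ℝ) ^ δ⌉₊ u = false → ∀ e, u e = true → ∑ j, μ u j * t j e ≤ -1 := by
  intro h
  obtain ⟨δ, hδ, hδ2, hhard⟩ := convexGateBlind_iff_cliqueDistConeRankHard.mp h
  exact ⟨δ, hδ, hδ2, negCoverHard_of_cliqueDistConeRankHard hδ hhard⟩

/-! ### The counting interface for lower bounds on negative covers -/

/-- **One generator already has negative total on a covered graph.** If a conic combination of the `t_j` is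
`≤ -1` on every edge of a non-empty graph `u`, then some single `t_j` has negative total weight on `u`. [folklore] -/
theorem exists_neg_sum_of_negCover {m s : ℕ} (t : Fin s → (⊤ : SimpleGraph (Fin m)).edgeSet → ℝ)
    (μ : Fin s → ℝ) (hμ : ∀ j, 0 ≤ μ j) (u : (⊤ : SimpleGraph (Fin m)).edgeSet → Bool)
    (hne : ∃ e, u e = true) (hneg : ∀ e, u e = true → ∑ j, μ j * t j e ≤ -1) :
    ∃ j, ∑ e, (if u e = true then t j e else 0) < 0 := by
  classical
  by_contra hcon
  push Not at hcon
  obtain ⟨e₀, he₀⟩ := hne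
  -- `∑_e [u e] ∑_j μ_j t_j e ≤ -1 < 0`, but it equals `∑_j μ_j ∑_e [u e] t_j e ≥ 0`
  have hlt : ∑ e, (if u e = true then ∑ j, μ j * t j e else 0) < 0 := by
    have hle : ∀ e ∈ (Finset.univ : Finset (⊤ : SimpleGraph (Fin m)).edgeSet),
        (if u e = true then ∑ j, μ j * t j e else 0) ≤ 0 := by
      intro e _
      split_ifs with hue
      · linarith [hneg e hue]
      · exact le_rfl
    have hlt0 : (if u e₀ = true then ∑ j, μ j * t j e₀ else 0) < 0 := by
      rw [if_pos he₀]; linarith [hneg e₀ he₀]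
    calc ∑ e, (if u e = true then ∑ j, μ j * t j e else 0)
        < ∑ e, (0 : ℝ) := Finset.sum_lt_sum hle ⟨e₀, Finset.mem_univ _, hlt0⟩
      _ = 0 := Finset.sum_const_zero
  have hge : 0 ≤ ∑ e, (if u e = true then ∑ j, μ j * t j e else 0) := by
    have hswap : ∑ e, (if u e = true then ∑ j, μ j * t j e else 0) =
        ∑ j, μ j * ∑ e, (if u e = true then t j e else 0) := by
      simp only [Finset.mul_sum]
      rw [Finset.sum_comm]
      refine Finset.sum_congr rfl fun e _ => ?_
      by_cases hue : u e = true
      · simp only [if_pos hue]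
      · simp only [if_neg hue, mul_zero, Finset.sum_const_zero]
    rw [hswap]
    exact Finset.sum_nonneg fun j _ => mul_nonneg (hμ j) (hcon j)
  linarith

/-- **Counting bound.** If every graph of a finite family `𝒰` of non-empty graphs is negatively covered by the family
`t₁, …, t_s`, and no single edge weighting that is non-negative on every `k`-set has negative total weight on more than
`N` members of `𝒰`, then `#𝒰 ≤ s · N`. (So `s ≥ #𝒰 / N`: lower bounds on negative covers reduce to the extremal
question "how many clique-free graphs of `𝒰` can ONE clique-non-negative weighting make negative".) [folklore] -/
theorem card_le_mul_of_negCover {m k s N : ℕ}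
    (𝒰 : Finset ((⊤ : SimpleGraph (Fin m)).edgeSet → Bool)) (h𝒰 : ∀ u ∈ 𝒰, ∃ e, u e = true)
    (t : Fin s → (⊤ : SimpleGraph (Fin m)).edgeSet → ℝ)
    (ht : ∀ j (Q : Finset (Fin m)), Q.card = k → 0 ≤ ∑ e, if cliqueVec Q e = true then t j e else 0)
    (μ : ((⊤ : SimpleGraph (Fin m)).edgeSet → Bool) → Fin s → ℝ) (hμ : ∀ u j, 0 ≤ μ u j)
    (hneg : ∀ u ∈ 𝒰, ∀ e, u e = true → ∑ j, μ u j * t j e ≤ -1)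
    (hN : ∀ w : (⊤ : SimpleGraph (Fin m)).edgeSet → ℝ,
      (∀ Q : Finset (Fin m), Q.card = k → 0 ≤ ∑ e, if cliqueVec Q e = true then w e else 0) →
      (𝒰.filter fun u => ∑ e, (if u e = true then w e else 0) < 0).card ≤ N) :
    𝒰.card ≤ s * N := by
  classical
  -- each `u ∈ 𝒰` is charged to a generator with negative total on it
  have hcover : ∀ u ∈ 𝒰, ∃ j : Fin s, ∑ e, (if u e = true then t j e else 0) < 0 := fun u hu =>
    exists_neg_sum_of_negCover t (μ u) (hμ u) u (h𝒰 u hu) (hneg u hu)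
  calc 𝒰.card ≤ ((Finset.univ : Finset (Fin s)).biUnion fun j =>
        𝒰.filter fun u => ∑ e, (if u e = true then t j e else 0) < 0).card := by
        refine Finset.card_le_card fun u hu => ?_
        obtain ⟨j, hj⟩ := hcover u hu
        exact Finset.mem_biUnion.2 ⟨j, Finset.mem_univ _, Finset.mem_filter.2 ⟨hu, hj⟩⟩
    _ ≤ ∑ j : Fin s, (𝒰.filter fun u => ∑ e, (if u e = true then t j e else 0) < 0).card :=
        Finset.card_biUnion_le
    _ ≤ ∑ _j : Fin s, N := Finset.sum_le_sum fun j _ => hN (t j) (ht j)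
    _ = s * N := by rw [Finset.sum_const, Finset.card_univ, Fintype.card_fin, smul_eq_mul]

end Summit.PneNP.PneNP.Theorems
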